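import Mathlib.Analysis.Calculus.MeanValue
import HarnessLib

/-!
# Uniform-in-space differentiability of time-dependent families: sum, product and chain rules
# (toolkit for Bauerschmidt–Bodineau–Dagallier §3.3, proof of Theorem 3)

Topic `Literature/Analysis/FunctionSpaces`; eleventh "proof architecture" file behind the named fact
`Polchinski.BauerschmidtBodineau_multiscaleBakryEmery` ([BBD] Theorem 3, `MultiscaleBakryEmery.lean`).
The differentiation rules for fluctuation averages of time-dependent families
(`hasDerivAt_integral_family_Cinf_sub`, `hasDerivAt_renormExpect_family`) take as hypothesis that
`s ↦ K_s(y)` is differentiable at `s = t` UNIFORMLY in `y`: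
`∀ ε > 0, eventually in s, ∀ y, |K_s(y) − K_t(y) − (s−t)K̇(y)| ≤ ε|s−t|`.
In [BBD]'s proof of Theorem 3 the family is `Φ(P_{0,t}F) = Φ(W_t/Z_t)` (p0016 L40–75), assembled from the
uniformly differentiable Gaussian averages `W_t`, `Z_t` (`eventually_abs_integral_sub_sub_mul_le`) by
products, quotients and composition with `Φ`.  This file provides the corresponding closure rules for the
uniform slope property — the uniform versions of the sum, product and chain rules of one-variable
calculus (Rudin, Thms 5.3, 5.5), with explicit use of boundedness.

## Main results (sorry-free; no new definitions, no new named facts)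

* `uniformSlope_add`, `uniformSlope_const_mul`, `uniformSlope_mul` — sum / scalar / product rules.
* `eventually_abs_sub_le_of_uniformSlope` — a uniform slope gives a uniform Lipschitz-in-time bound.
* `abs_sub_sub_mul_le_of_lipschitz_deriv` — the Taylor bound `|Φ(b) − Φ(a) − Φ′(a)(b−a)| ≤ L|b−a|²`
  for `Φ′` `L`-Lipschitz; `uniformSlope_comp` — the chain rule `Φ(f_s)` with slope `Φ′(f_t)ḟ`.

Nothing here concerns Yang–Mills.

## References

* [BauerschmidtBodineauDagallier2023] R. Bauerschmidt, T. Bodineau, B. Dagallier, Probab. Surveys 21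
  (2024) 200–290, arXiv:2307.07619 — proof of Theorem 3, p0016 L40–88. READ (held).
* [Rudin1976] W. Rudin, Principles of Mathematical Analysis, 3rd ed. — Thm 5.3 (product rule),
  Thm 5.5 (chain rule), Thm 5.15 (Taylor).
-/

noncomputable section

open Filter Topology Set

namespace Literature.Analysis.FunctionSpaces

namespace Polchinski

section UniformSlope

variable {α : Type*} {t : ℝ}

/-- **Sum rule** for uniform slopes. [cite: Rudin1976, Thm 5.3] -/
theorem uniformSlope_add {f g : ℝ → α → ℝ} {fd gd : α → ℝ}
    (hf : ∀ ε : ℝ, 0 < ε → ∀ᶠ s in 𝓝 t, ∀ y, |f s y - f t y - (s - t) * fd y| ≤ ε * |s - t|)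
    (hg : ∀ ε : ℝ, 0 < ε → ∀ᶠ s in 𝓝 t, ∀ y, |g s y - g t y - (s - t) * gd y| ≤ ε * |s - t|) :
    ∀ ε : ℝ, 0 < ε → ∀ᶠ s in 𝓝 t, ∀ y,
      |(f s y + g s y) - (f t y + g t y) - (s - t) * (fd y + gd y)| ≤ ε * |s - t| := by
  intro ε hε
  filter_upwards [hf (ε / 2) (half_pos hε), hg (ε / 2) (half_pos hε)] with s hs1 hs2 y
  have h1 := hs1 y
  have h2 := hs2 y
  have he : (f s y + g s y) - (f t y + g t y) - (s - t) * (fd y + gd y) =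
      (f s y - f t y - (s - t) * fd y) + (g s y - g t y - (s - t) * gd y) := by ring
  rw [he]
  calc _ ≤ |f s y - f t y - (s - t) * fd y| + |g s y - g t y - (s - t) * gd y| := abs_add_le _ _
    _ ≤ ε / 2 * |s - t| + ε / 2 * |s - t| := add_le_add h1 h2
    _ = ε * |s - t| := by ring

/-- **Scalar rule** for uniform slopes. [cite: Rudin1976, Thm 5.3] -/
theorem uniformSlope_const_mul {f : ℝ → α → ℝ} {fd : α → ℝ} (c : ℝ)
    (hf : ∀ ε : ℝ, 0 < ε → ∀ᶠ s in 𝓝 t, ∀ y, |f s y - f t y - (s - t) * fd y| ≤ ε * |s - t|) :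
    ∀ ε : ℝ, 0 < ε → ∀ᶠ s in 𝓝 t, ∀ y,
      |c * f s y - c * f t y - (s - t) * (c * fd y)| ≤ ε * |s - t| := by
  intro ε hε
  filter_upwards [hf (ε / (|c| + 1)) (by positivity)] with s hs y
  have h1 := hs y
  have he : c * f s y - c * f t y - (s - t) * (c * fd y) = c * (f s y - f t y - (s - t) * fd y) := by
    ring
  rw [he, abs_mul]
  calc |c| * |f s y - f t y - (s - t) * fd y| ≤ |c| * (ε / (|c| + 1) * |s - t|) :=
        mul_le_mul_of_nonneg_left h1 (abs_nonneg c)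
    _ ≤ ε * |s - t| := by
        have h3 : |c| * (ε / (|c| + 1)) ≤ ε := by
          rw [mul_div_assoc', div_le_iff₀ (by positivity)]
          nlinarith [abs_nonneg c]
        have h4 : 0 ≤ |s - t| := abs_nonneg _
        nlinarith

/-- **A uniform slope gives a uniform Lipschitz-in-time bound**: eventually `sup_y |f_s(y) − f_t(y)| ≤ (sup|ḟ| + 1)|s−t|`.
[cite: Rudin1976, Thm 5.3 (proof)] -/
theorem eventually_abs_sub_le_of_uniformSlope {f : ℝ → α → ℝ} {fd : α → ℝ}
    (hf : ∀ ε : ℝ, 0 < ε → ∀ᶠ s in 𝓝 t, ∀ y, |f s y - f t y - (s - t) * fd y| ≤ ε * |s - t|)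
    {A : ℝ} (hA : ∀ y, |fd y| ≤ A) :
    ∀ᶠ s in 𝓝 t, ∀ y, |f s y - f t y| ≤ (A + 1) * |s - t| := by
  filter_upwards [hf 1 one_pos] with s hs y
  have h := hs y
  calc |f s y - f t y| = |(f s y - f t y - (s - t) * fd y) + (s - t) * fd y| := by ring_nf
    _ ≤ |f s y - f t y - (s - t) * fd y| + |(s - t) * fd y| := abs_add_le _ _
    _ ≤ 1 * |s - t| + |s - t| * A := by
        rw [abs_mul]
        exact add_le_add h (mul_le_mul_of_nonneg_left (hA y) (abs_nonneg _))
    _ = (A + 1) * |s - t| := by ring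

/-- `|s − t|` is eventually small. [folklore] -/
private theorem eventually_abs_sub_lt (t : ℝ) {c : ℝ} (hc : 0 < c) : ∀ᶠ s in 𝓝 t, |s - t| < c := by
  have h0 : Tendsto (fun s : ℝ => s - t) (𝓝 t) (𝓝 (t - t)) := tendsto_id.sub_const t
  rw [sub_self] at h0
  have h := h0.abs
  rw [abs_zero] at h
  exact (tendsto_order.1 h).2 _ hc

/-- **Product rule** for uniform slopes of bounded families: if `|f_t| ≤ A`, `|g_s| ≤ B` (all `s`),
`|ḟ| ≤ A'`, `|ġ| ≤ B'`, then `f_s g_s` has the uniform slope `ḟ g_t + f_t ġ` at `t`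
(uniform version of the product rule). [cite: Rudin1976, Thm 5.3] -/
theorem uniformSlope_mul {f g : ℝ → α → ℝ} {fd gd : α → ℝ}
    (hf : ∀ ε : ℝ, 0 < ε → ∀ᶠ s in 𝓝 t, ∀ y, |f s y - f t y - (s - t) * fd y| ≤ ε * |s - t|)
    (hg : ∀ ε : ℝ, 0 < ε → ∀ᶠ s in 𝓝 t, ∀ y, |g s y - g t y - (s - t) * gd y| ≤ ε * |s - t|)
    {A : ℝ} (hA : ∀ y, |f t y| ≤ A) {B : ℝ} (hB : ∀ s y, |g s y| ≤ B)
    {A' : ℝ} (hA' : ∀ y, |fd y| ≤ A') {B' : ℝ} (hB' : ∀ y, |gd y| ≤ B') :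
    ∀ ε : ℝ, 0 < ε → ∀ᶠ s in 𝓝 t, ∀ y,
      |f s y * g s y - f t y * g t y - (s - t) * (fd y * g t y + f t y * gd y)| ≤ ε * |s - t| := by
  intro ε hε
  have ev1 := hf (ε / (3 * (|B| + 1))) (by positivity)
  have ev2 := hg (ε / (3 * (|A| + 1))) (by positivity)
  have ev3 := eventually_abs_sub_le_of_uniformSlope hg hB'
  have ev4 := eventually_abs_sub_lt t (c := ε / (3 * (|A'| * (|B'| + 1) + 1))) (by positivity)
  filter_upwards [ev1, ev2, ev3, ev4] with s hs1 hs2 hs3 hs4 y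
  set a : ℝ := |s - t| with ha
  have ha0 : 0 ≤ a := abs_nonneg _
  have h1 := hs1 y
  have h2 := hs2 y
  have h3 : |g s y - g t y| ≤ (|B'| + 1) * a :=
    (hs3 y).trans (mul_le_mul_of_nonneg_right (by linarith [le_abs_self B']) ha0)
  have hdec : f s y * g s y - f t y * g t y - (s - t) * (fd y * g t y + f t y * gd y) =
      (f s y - f t y - (s - t) * fd y) * g s y + (s - t) * fd y * (g s y - g t y) +
        f t y * (g s y - g t y - (s - t) * gd y) := by ring
  rw [hdec]
  have hT1 : |(f s y - f t y - (s - t) * fd y) * g s y| ≤ ε / (3 * (|B| + 1)) * a * |B| := by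
    rw [abs_mul]
    exact mul_le_mul h1 ((hB s y).trans (le_abs_self B)) (abs_nonneg _) (by positivity)
  have hT2 : |(s - t) * fd y * (g s y - g t y)| ≤ a * |A'| * ((|B'| + 1) * a) := by
    rw [abs_mul, abs_mul]
    exact mul_le_mul (mul_le_mul_of_nonneg_left ((hA' y).trans (le_abs_self A')) ha0) h3
      (abs_nonneg _) (by positivity)
  have hT3 : |f t y * (g s y - g t y - (s - t) * gd y)| ≤ |A| * (ε / (3 * (|A| + 1)) * a) := by
    rw [abs_mul]
    exact mul_le_mul ((hA y).trans (le_abs_self A)) h2 (abs_nonneg _) (abs_nonneg A)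
  have hN1 : ε / (3 * (|B| + 1)) * a * |B| ≤ ε / 3 * a := by
    have h : ε / (3 * (|B| + 1)) * |B| ≤ ε / 3 := by
      rw [div_mul_eq_mul_div, div_le_div_iff₀ (by positivity) (by positivity)]
      nlinarith [abs_nonneg B]
    nlinarith [abs_nonneg B]
  have hN2 : a * |A'| * ((|B'| + 1) * a) ≤ ε / 3 * a := by
    have h : |A'| * (|B'| + 1) * a ≤ ε / 3 := by
      have h5 : (|A'| * (|B'| + 1) + 1) * a < ε / 3 := by
        have := hs4
        rw [lt_div_iff₀ (by positivity)] at this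
        linarith
      have : 0 ≤ 1 * a := by positivity
      linarith
    calc a * |A'| * ((|B'| + 1) * a) = (|A'| * (|B'| + 1) * a) * a := by ring
      _ ≤ ε / 3 * a := mul_le_mul_of_nonneg_right h ha0
  have hN3 : |A| * (ε / (3 * (|A| + 1)) * a) ≤ ε / 3 * a := by
    have h : |A| * (ε / (3 * (|A| + 1))) ≤ ε / 3 := by
      rw [mul_div_assoc', div_le_div_iff₀ (by positivity) (by positivity)]
      nlinarith [abs_nonneg A]
    calc |A| * (ε / (3 * (|A| + 1)) * a) = (|A| * (ε / (3 * (|A| + 1)))) * a := by ring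
      _ ≤ ε / 3 * a := mul_le_mul_of_nonneg_right h ha0
  calc _ ≤ |(f s y - f t y - (s - t) * fd y) * g s y| + |(s - t) * fd y * (g s y - g t y)| +
        |f t y * (g s y - g t y - (s - t) * gd y)| := abs_add_three _ _ _
    _ ≤ ε / 3 * a + ε / 3 * a + ε / 3 * a :=
        add_le_add (add_le_add (hT1.trans hN1) (hT2.trans hN2)) (hT3.trans hN3)
    _ = ε * a := by ring

/-- **Taylor bound from a Lipschitz derivative**: if `Φ′` is `L`-Lipschitz then
`|Φ(b) − Φ(a) − Φ′(a)(b − a)| ≤ L |b − a|²`. [cite: Rudin1976, Thm 5.15] -/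
theorem abs_sub_sub_mul_le_of_lipschitz_deriv {Φ Φ' : ℝ → ℝ} (hΦ : ∀ x, HasDerivAt Φ (Φ' x) x)
    {L : ℝ} (hL : ∀ x y, |Φ' x - Φ' y| ≤ L * |x - y|) (a b : ℝ) :
    |Φ b - Φ a - Φ' a * (b - a)| ≤ L * |b - a| ^ 2 := by
  -- `g(x) = Φ(x) − Φ′(a)·x` has derivative `Φ′(x) − Φ′(a)`, bounded by `L|b − a|` on the segment
  have hg : ∀ x ∈ uIcc a b, HasDerivWithinAt (fun x => Φ x - Φ' a * x) (Φ' x - Φ' a) (uIcc a b) x :=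
    fun x _ => ((hΦ x).sub ((hasDerivAt_id x).const_mul (Φ' a))).hasDerivWithinAt.congr_deriv (by simp)
  have hL0 : 0 ≤ L := by
    have h := (abs_nonneg _).trans (hL 1 0)
    simpa using h
  have hbound : ∀ x ∈ uIcc a b, ‖Φ' x - Φ' a‖ ≤ L * |b - a| := by
    intro x hx
    rw [Real.norm_eq_abs]
    exact (hL x a).trans (mul_le_mul_of_nonneg_left (abs_sub_left_of_mem_uIcc hx) hL0)
  have h := Convex.norm_image_sub_le_of_norm_hasDerivWithin_le hg hbound (convex_uIcc a b)
    left_mem_uIcc right_mem_uIcc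
  rw [Real.norm_eq_abs, Real.norm_eq_abs] at h
  have he : Φ b - Φ' a * b - (Φ a - Φ' a * a) = Φ b - Φ a - Φ' a * (b - a) := by ring
  rw [he] at h
  calc |Φ b - Φ a - Φ' a * (b - a)| ≤ L * |b - a| * |b - a| := h
    _ = L * |b - a| ^ 2 := by ring

/-- **Chain rule** for uniform slopes: if `f_s` has uniform slope `ḟ` at `t` with `|ḟ| ≤ A'`, and
`Φ : ℝ → ℝ` is differentiable with `|Φ′| ≤ P₁` and `Φ′` `P₂`-Lipschitz, then `Φ(f_s)` has the uniform slope
`Φ′(f_t)ḟ` at `t` (uniform version of the chain rule; [BBD] apply it with `Φ(x) = x log x` extended from a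
compact `I ⊂ (0,∞)` to a bounded smooth function, p0016 L40–45). [cite: Rudin1976, Thm 5.5] -/
theorem uniformSlope_comp {f : ℝ → α → ℝ} {fd : α → ℝ}
    (hf : ∀ ε : ℝ, 0 < ε → ∀ᶠ s in 𝓝 t, ∀ y, |f s y - f t y - (s - t) * fd y| ≤ ε * |s - t|)
    {A' : ℝ} (hA' : ∀ y, |fd y| ≤ A')
    {Φ Φ' : ℝ → ℝ} (hΦ : ∀ x, HasDerivAt Φ (Φ' x) x) {P1 : ℝ} (hP1 : ∀ x, |Φ' x| ≤ P1)
    {P2 : ℝ} (hP2 : ∀ x y, |Φ' x - Φ' y| ≤ P2 * |x - y|) :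
    ∀ ε : ℝ, 0 < ε → ∀ᶠ s in 𝓝 t, ∀ y,
      |Φ (f s y) - Φ (f t y) - (s - t) * (Φ' (f t y) * fd y)| ≤ ε * |s - t| := by
  intro ε hε
  have ev1 := hf (ε / (2 * (|P1| + 1))) (by positivity)
  have ev2 := eventually_abs_sub_le_of_uniformSlope hf hA'
  have ev3 := eventually_abs_sub_lt t (c := ε / (2 * (|P2| * (|A'| + 1) ^ 2 + 1))) (by positivity)
  filter_upwards [ev1, ev2, ev3] with s hs1 hs2 hs3 y
  set a : ℝ := |s - t| with ha
  have ha0 : 0 ≤ a := abs_nonneg _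
  have h1 := hs1 y
  have h2 : |f s y - f t y| ≤ (|A'| + 1) * a :=
    (hs2 y).trans (mul_le_mul_of_nonneg_right (by linarith [le_abs_self A']) ha0)
  have hdec : Φ (f s y) - Φ (f t y) - (s - t) * (Φ' (f t y) * fd y) =
      (Φ (f s y) - Φ (f t y) - Φ' (f t y) * (f s y - f t y)) +
        Φ' (f t y) * (f s y - f t y - (s - t) * fd y) := by ring
  rw [hdec]
  have hT1 : |Φ (f s y) - Φ (f t y) - Φ' (f t y) * (f s y - f t y)| ≤ |P2| * ((|A'| + 1) * a) ^ 2 := by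
    refine (abs_sub_sub_mul_le_of_lipschitz_deriv hΦ hP2 (f t y) (f s y)).trans ?_
    exact mul_le_mul (le_abs_self P2) (pow_le_pow_left₀ (abs_nonneg _) h2 2) (by positivity)
      (abs_nonneg _)
  have hT2 : |Φ' (f t y) * (f s y - f t y - (s - t) * fd y)| ≤ |P1| * (ε / (2 * (|P1| + 1)) * a) := by
    rw [abs_mul]
    exact mul_le_mul ((hP1 _).trans (le_abs_self P1)) h1 (abs_nonneg _) (abs_nonneg P1)
  have hN1 : |P2| * ((|A'| + 1) * a) ^ 2 ≤ ε / 2 * a := by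
    have h : |P2| * (|A'| + 1) ^ 2 * a ≤ ε / 2 := by
      have h5 : (|P2| * (|A'| + 1) ^ 2 + 1) * a < ε / 2 := by
        have := hs3
        rw [lt_div_iff₀ (by positivity)] at this
        linarith
      have : 0 ≤ 1 * a := by positivity
      linarith
    calc |P2| * ((|A'| + 1) * a) ^ 2 = (|P2| * (|A'| + 1) ^ 2 * a) * a := by ring
      _ ≤ ε / 2 * a := mul_le_mul_of_nonneg_right h ha0
  have hN2 : |P1| * (ε / (2 * (|P1| + 1)) * a) ≤ ε / 2 * a := by
    have h : |P1| * (ε / (2 * (|P1| + 1))) ≤ ε / 2 := by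
      rw [mul_div_assoc', div_le_div_iff₀ (by positivity) (by positivity)]
      nlinarith [abs_nonneg P1]
    calc |P1| * (ε / (2 * (|P1| + 1)) * a) = (|P1| * (ε / (2 * (|P1| + 1)))) * a := by ring
      _ ≤ ε / 2 * a := mul_le_mul_of_nonneg_right h ha0
  calc _ ≤ |Φ (f s y) - Φ (f t y) - Φ' (f t y) * (f s y - f t y)| +
        |Φ' (f t y) * (f s y - f t y - (s - t) * fd y)| := abs_add_le _ _
    _ ≤ ε / 2 * a + ε / 2 * a := add_le_add (hT1.trans hN1) (hT2.trans hN2)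
    _ = ε * a := by ring

end UniformSlope

end Polchinski

end Literature.Analysis.FunctionSpaces

end
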